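import Literature.Probability.LatticeModels.GoodCrossingCaseIW
import Literature.Probability.LatticeModels.OrientationReflect
import HarnessLib

/-!
# The structured good crossing with the `+`face on the right (contour-free GH2000 L5.5 Case 3)

Topic `Probability/LatticeModels`; theorems only. The structured estimate
`le_measureReal_goodTriple_of_pinning` (`GoodCrossingCaseIW.lean`) assumes that the infinite
`+∗`cluster of the upper half-plane touches the axis unboundedly on the left. As in
`OrientationReflect.lean` ("the alternative case is analogous", Georgii–Higuchi 2000, p. 15), the
case of the `+`face on the right follows by the reflection `x₁ ↦ -x₁` of both layers, which turns
`μ ⊗ (μ ∘ θ_s⁻¹)` into `μ_R ⊗ (μ_R ∘ θ_{-s}⁻¹)`; the three pieces of the structured walk are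
reflected and their roles exchanged (`le_measureReal_goodTriple_of_pinning_right`). Only inclusions
of events are transported (`Measure.le_map_apply`), except for the structured event itself, which is
measurable (`measurableSet_goodTriple`).

## References

* H.-O. Georgii, Y. Higuchi, J. Math. Phys. 41 (2000) 1153–1169, Lemma 5.5, proof, Case 3 (p. 15)
  [GeorgiiHiguchi2000].
-/

noncomputable section

open MeasureTheory Filter SimpleGraph
open Literature.Probability.Percolation
open scoped ENNReal

namespace Literature.Probability.LatticeModels

/-! ### The structured event -/

section Events

/-- **The structured good-walk event is measurable.** [folklore] -/
theorem measurableSet_goodTriple (x y : Site 2) (Qx PM Qy : Site 2 → Prop) :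
    MeasurableSet {p : SpinConfig (Site 2) × SpinConfig (Site 2) | ∃ a' b' : Site 2, ∃ Px : zdStarGraph.Walk x a',
      ∃ M : zdStarGraph.Walk a' b', ∃ Py : zdStarGraph.Walk y b',
        (∀ v ∈ Px.support, p.1 v ≤ p.2 v ∧ Qx v) ∧ (∀ v ∈ M.support, p.1 v ≤ p.2 v ∧ PM v) ∧
          (∀ v ∈ Py.support, p.1 v ≤ p.2 v ∧ Qy v)} := by
  have : {p : SpinConfig (Site 2) × SpinConfig (Site 2) | ∃ a' b' : Site 2, ∃ Px : zdStarGraph.Walk x a',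
      ∃ M : zdStarGraph.Walk a' b', ∃ Py : zdStarGraph.Walk y b',
        (∀ v ∈ Px.support, p.1 v ≤ p.2 v ∧ Qx v) ∧ (∀ v ∈ M.support, p.1 v ≤ p.2 v ∧ PM v) ∧
          (∀ v ∈ Py.support, p.1 v ≤ p.2 v ∧ Qy v)} =
      ⋃ a' : Site 2, ⋃ b' : Site 2,
        {p | ∃ Px : zdStarGraph.Walk x a', ∀ v ∈ Px.support, p.1 v ≤ p.2 v ∧ Qx v} ∩
          ({p | ∃ M : zdStarGraph.Walk a' b', ∀ v ∈ M.support, p.1 v ≤ p.2 v ∧ PM v} ∩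
            {p | ∃ Py : zdStarGraph.Walk y b', ∀ v ∈ Py.support, p.1 v ≤ p.2 v ∧ Qy v}) := by
    ext p
    simp only [Set.mem_setOf_eq, Set.mem_iUnion, Set.mem_inter_iff]
    constructor
    · rintro ⟨a', b', Px, M, Py, h1, h2, h3⟩; exact ⟨a', b', ⟨Px, h1⟩, ⟨M, h2⟩, ⟨Py, h3⟩⟩
    · rintro ⟨a', b', ⟨Px, h1⟩, ⟨M, h2⟩, ⟨Py, h3⟩⟩; exact ⟨a', b', Px, M, Py, h1, h2, h3⟩
  rw [this]
  exact MeasurableSet.iUnion fun a' => MeasurableSet.iUnion fun b' =>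
    (measurableSet_goodCrossing _ _ _).inter ((measurableSet_goodCrossing _ _ _).inter (measurableSet_goodCrossing _ _ _))

/-- Reflecting a `∗`-walk by `x₁ ↦ -x₁`. [folklore] -/
theorem exists_starWalk_reflectZero {x y : Site 2} {P : Site 2 → Prop}
    (h : ∃ w : zdStarGraph.Walk x y, ∀ v ∈ w.support, P v) :
    ∃ w : zdStarGraph.Walk (reflectCoord 0 x) (reflectCoord 0 y), ∀ v ∈ w.support, P (reflectCoord 0 v) := by
  obtain ⟨w, hw⟩ := h
  have key : ∀ v ∈ (w.map (starReflectHom 0)).support, P (reflectCoord 0 v) := by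
    intro v hv
    rw [Walk.support_map, List.mem_map] at hv
    obtain ⟨z, hz, rfl⟩ := hv
    rw [starReflectHom_apply, reflectCoord_reflectCoord]; exact hw z hz
  refine ⟨(w.map (starReflectHom 0)).copy (starReflectHom_apply 0 x) (starReflectHom_apply 0 y), fun v hv => key v ?_⟩
  rw [Walk.support_copy] at hv
  exact hv

end Events

/-! ### The right orientation -/

section Right

variable {β : ℝ} {μ : Measure (SpinConfig (Site 2))}

/-- **The structured good crossing with the `+`face on the right, from two-part pins**: `x` pinned by
`-`sites (`Qx`, then `PM`) in the first layer, `y` by `+`sites (`Qy`, then `PM`) in the second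
layer; `PM ⊇ π_up` symmetric under `x₁ ↦ -x₁`. Same conclusion as
`le_measureReal_goodTriple_of_pinning`. [cite: GeorgiiHiguchi2000, Lemma 5.5 (proof, Case 3, p. 15)] -/
theorem le_measureReal_goodTriple_of_pinning_right (hβc : criticalBeta 2 < β) (hμ : μ ∈ isingGibbsMeasures 2 β 0)
    (hμt : IsTailTrivial μ) (s : ℤˣ)
    (hR : ∀ᵐ ω ∂μ, ∃ x, ∀ n : ℕ, ∃ k : ℤ, (n : ℤ) < k ∧
      (![k, 0] : Site 2) ∈ siteCluster zdStarGraph (spinSites 1 ω ∩ halfPlane 0) x)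
    (hC : ∀ᵐ ω ∂μ, ∃ y, (siteCluster (zdGraph 2) (spinSites (-1) ω ∩ halfPlane 0) y).Infinite)
    {Qx PM Qy : Site 2 → Prop} (hPM : ∀ v : Site 2, 0 ≤ v 1 → PM v) (hPMR : ∀ v : Site 2, PM (reflectCoord 0 v) ↔ PM v)
    (x y : Site 2) {cP : ℝ}
    (hpinx : cP ≤ μ.real
      {ω : SpinConfig (Site 2) | ∃ z, (siteCluster (zdGraph 2) (spinSites (-1) ω ∩ halfPlane 0) z).Infinite ∧
        ∃ a' : Site 2, ∃ P : zdStarGraph.Walk x a', ∃ N : zdStarGraph.Walk a' z,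
          (∀ v ∈ P.support, ω v = -1 ∧ Qx v) ∧ (∀ v ∈ N.support, ω v = -1 ∧ PM v)})
    (hpiny : cP ≤ (μ.map (configShift (Pi.single 0 (s : ℤ)))).real
      {ω : SpinConfig (Site 2) | ∃ z, (siteCluster zdStarGraph (spinSites 1 ω ∩ halfPlane 0) z).Infinite ∧
        ∃ b' : Site 2, ∃ P : zdStarGraph.Walk y b', ∃ N : zdStarGraph.Walk b' z,
          (∀ v ∈ P.support, ω v = 1 ∧ Qy v) ∧ (∀ v ∈ N.support, ω v = 1 ∧ PM v)})
    (hcP : 0 ≤ cP) :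
    ((1 - (1 + ENNReal.ofReal (Real.exp (-(8 * |β|)) / 2))⁻¹) / 2).toReal * cP * cP ≤
      (μ.prod (μ.map (configShift (Pi.single 0 (s : ℤ))))).real
        {p : SpinConfig (Site 2) × SpinConfig (Site 2) | ∃ a' b' : Site 2, ∃ Px : zdStarGraph.Walk x a',
          ∃ M : zdStarGraph.Walk a' b', ∃ Py : zdStarGraph.Walk y b',
            (∀ v ∈ Px.support, p.1 v ≤ p.2 v ∧ Qx v) ∧ (∀ v ∈ M.support, p.1 v ≤ p.2 v ∧ PM v) ∧
              (∀ v ∈ Py.support, p.1 v ≤ p.2 v ∧ Qy v)} := by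
  classical
  have hμG : IsGibbsMeasure (isingSpecification (zdGraph 2) β 0) μ := hμ
  haveI := hμG.isProbabilityMeasure
  set ρ : SpinConfig (Site 2) → SpinConfig (Site 2) := ⇑(configRelabel (reflectCoord (d := 2) 0).toEquiv) with hρ
  have hρm : Measurable ρ := (configRelabel _).measurable
  set μR : Measure (SpinConfig (Site 2)) := μ.map ρ with hμR
  have hμRG : μR ∈ isingGibbsMeasures 2 β 0 := IsGibbsMeasure.map_configRelabel _ (reflectCoord 0) hμG
  have hμRt : IsTailTrivial μR := hμt.map_configRelabel _
  have hsm : Measurable (configShift (S := ℤˣ) (Pi.single (0 : Fin 2) (s : ℤ)) : SpinConfig (Site 2) → SpinConfig (Site 2)) :=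
    (configShift _).measurable
  have hs'm : Measurable (configShift (S := ℤˣ) (Pi.single (0 : Fin 2) (-(s : ℤ))) : SpinConfig (Site 2) → SpinConfig (Site 2)) :=
    (configShift _).measurable
  haveI : IsProbabilityMeasure (μ.map (configShift (S := ℤˣ) (Pi.single (0 : Fin 2) (s : ℤ)))) :=
    Measure.isProbabilityMeasure_map hsm.aemeasurable
  haveI : IsProbabilityMeasure μR := Measure.isProbabilityMeasure_map hρm.aemeasurable
  have hρρ : ∀ ω : SpinConfig (Site 2), ρ (ρ ω) = ω := fun ω =>
    congrFun configRelabel_reflectCoord_zero_comp_self ω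
  have hρapp : ∀ (ω : SpinConfig (Site 2)) (v : Site 2), ρ ω v = ω (reflectCoord 0 v) := fun ω v => by
    rw [hρ, configRelabel_apply, reflectCoord_symm_apply]
  have hφ1 : ∀ z : Site 2, ((reflectCoord (d := 2) 0) z) 1 = z 1 := fun z => (reflectCoord_zero_apply z).2
  -- hypotheses for the reflected measure
  have hL' : ∀ᵐ ω ∂μR, ∃ x, ∀ n : ℕ, ∃ k : ℤ, k < -(n : ℤ) ∧
      (![k, 0] : Site 2) ∈ siteCluster zdStarGraph (spinSites 1 ω ∩ halfPlane 0) x := by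
    rw [hμR, ae_map_iff hρm.aemeasurable (measurableSet_axisUnboundedBelow_config (G := zdStarGraph) 1 (halfPlane 0))]
    filter_upwards [hR] with ω ⟨x₀, hx₀⟩
    refine ⟨reflectCoord 0 x₀, fun n => ?_⟩
    obtain ⟨k, hk, hmem⟩ := hx₀ n
    refine ⟨-k, by omega, ?_⟩
    rw [mem_siteCluster_reflectZero_iff, neg_neg, reflectCoord_reflectCoord]
    exact hmem
  have hC' : ∀ᵐ ω ∂μR, ∃ y, (siteCluster (zdGraph 2) (spinSites (-1) ω ∩ halfPlane 0) y).Infinite := by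
    rw [hμR, ae_map_iff hρm.aemeasurable (MeasurableSet.of_tailEvents
      (measurableSet_tailEvents_existsInfClusterIn (G := zdGraph 2) (-1) (halfPlane 0)))]
    filter_upwards [hC] with ω ⟨y₀, hy₀⟩
    refine ⟨reflectCoord 0 y₀, ?_⟩
    exact (infinite_siteCluster_configRelabel_iff (reflectCoord (d := 2) 0) hφ1 (-1) ω y₀).2 hy₀
  have hPM' : ∀ v : Site 2, 0 ≤ v 1 → PM (reflectCoord 0 v) := fun v hv => (hPMR v).2 (hPM v hv)
  -- the `∗`-automorphism of the reflection, for transporting infinite clusters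
  let φ : zdStarGraph ≃g zdStarGraph :=
    { toEquiv := (reflectCoord (d := 2) 0).toEquiv
      map_rel_iff' := by
        intro a b
        constructor
        · intro h
          have h' := (starReflectHom 0).map_rel h
          rw [starReflectHom_apply, starReflectHom_apply] at h'
          have ea : reflectCoord 0 ((reflectCoord (d := 2) 0).toEquiv a) = a := reflectCoord_reflectCoord 0 a
          have eb : reflectCoord 0 ((reflectCoord (d := 2) 0).toEquiv b) = b := reflectCoord_reflectCoord 0 b
          rw [ea, eb] at h'
          exact h'
        · intro h
          exact (starReflectHom 0).map_rel h }
  have hφ1' : ∀ z : Site 2, (φ z) 1 = z 1 := fun z => (reflectCoord_zero_apply z).2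
  have hφapp : ∀ z : Site 2, (φ z : Site 2) = reflectCoord 0 z := fun z => rfl
  -- transporting a real lower bound along `ρ` by an inclusion of events
  have transport : ∀ {ν : Measure (SpinConfig (Site 2))} [IsProbabilityMeasure ν] {E E' : Set (SpinConfig (Site 2))},
      cP ≤ ν.real E → E ⊆ ρ ⁻¹' E' → cP ≤ (ν.map ρ).real E' := by
    intro ν _ E E' hle hsub
    haveI : IsProbabilityMeasure (ν.map ρ) := Measure.isProbabilityMeasure_map hρm.aemeasurable
    refine hle.trans ?_
    simp only [measureReal_def]
    exact ENNReal.toReal_mono (measure_ne_top _ _) ((measure_mono hsub).trans (Measure.le_map_apply hρm.aemeasurable E'))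
  -- the pins of the reflected system
  have hshift : μR.map (configShift (Pi.single 0 (((-s : ℤˣ) : ℤ)))) = (μ.map (configShift (Pi.single 0 (s : ℤ)))).map ρ := by
    rw [Units.val_neg, hμR, Measure.map_map hs'm hρm, Measure.map_map hρm hsm, configRelabel_reflectCoord_zero_comp_configShift]
  have hpinx' : cP ≤ (μR.map (configShift (Pi.single 0 (((-s : ℤˣ) : ℤ))))).real
      {ω : SpinConfig (Site 2) | ∃ z, (siteCluster zdStarGraph (spinSites 1 ω ∩ halfPlane 0) z).Infinite ∧
        ∃ a' : Site 2, ∃ P : zdStarGraph.Walk (reflectCoord 0 y) a', ∃ N : zdStarGraph.Walk a' z,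
          (∀ v ∈ P.support, ω v = 1 ∧ Qy (reflectCoord 0 v)) ∧ (∀ v ∈ N.support, ω v = 1 ∧ PM (reflectCoord 0 v))} := by
    rw [hshift]
    refine transport hpiny ?_
    rintro ω ⟨z, hinf, b', P, N, hP, hN⟩
    refine ⟨reflectCoord 0 z, ?_, reflectCoord 0 b', ?_⟩
    · show (siteCluster zdStarGraph (spinSites 1 (configRelabel φ.toEquiv ω) ∩ halfPlane 0) (φ z)).Infinite
      rw [infinite_siteCluster_configRelabel_iff φ hφ1' 1 ω z]; exact hinf
    · obtain ⟨P', hP'⟩ := exists_starWalk_reflectZero (P := fun v => ω v = 1 ∧ Qy v) ⟨P, hP⟩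
      obtain ⟨N', hN'⟩ := exists_starWalk_reflectZero (P := fun v => ω v = 1 ∧ PM v) ⟨N, hN⟩
      refine ⟨P', N', fun v hv => ?_, fun v hv => ?_⟩
      · have := hP' v hv
        show ρ ω v = 1 ∧ Qy (reflectCoord 0 v)
        rw [hρapp]; exact this
      · have := hN' v hv
        show ρ ω v = 1 ∧ PM (reflectCoord 0 v)
        rw [hρapp]; exact this
  have hpiny' : cP ≤ μR.real
      {ω : SpinConfig (Site 2) | ∃ z, (siteCluster (zdGraph 2) (spinSites (-1) ω ∩ halfPlane 0) z).Infinite ∧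
        ∃ b' : Site 2, ∃ P : zdStarGraph.Walk (reflectCoord 0 x) b', ∃ N : zdStarGraph.Walk b' z,
          (∀ v ∈ P.support, ω v = -1 ∧ Qx (reflectCoord 0 v)) ∧ (∀ v ∈ N.support, ω v = -1 ∧ PM (reflectCoord 0 v))} := by
    rw [hμR]
    refine transport hpinx ?_
    rintro ω ⟨z, hinf, a', P, N, hP, hN⟩
    refine ⟨reflectCoord 0 z, ?_, reflectCoord 0 a', ?_⟩
    · show (siteCluster (zdGraph 2) (spinSites (-1) (configRelabel (reflectCoord (d := 2) 0).toEquiv ω) ∩ halfPlane 0)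
        (reflectCoord (d := 2) 0 z)).Infinite
      rw [infinite_siteCluster_configRelabel_iff (reflectCoord (d := 2) 0) hφ1 (-1) ω z]; exact hinf
    · obtain ⟨P', hP'⟩ := exists_starWalk_reflectZero (P := fun v => ω v = -1 ∧ Qx v) ⟨P, hP⟩
      obtain ⟨N', hN'⟩ := exists_starWalk_reflectZero (P := fun v => ω v = -1 ∧ PM v) ⟨N, hN⟩
      refine ⟨P', N', fun v hv => ?_, fun v hv => ?_⟩
      · have := hP' v hv
        show ρ ω v = -1 ∧ Qx (reflectCoord 0 v)
        rw [hρapp]; exact this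
      · have := hN' v hv
        show ρ ω v = -1 ∧ PM (reflectCoord 0 v)
        rw [hρapp]; exact this
  have key := le_measureReal_goodTriple_of_pinning hβc hμRG hμRt (-s) hL' hC' hPM'
    (Qx := fun v => Qy (reflectCoord 0 v)) (Qy := fun v => Qx (reflectCoord 0 v))
    (reflectCoord 0 y) (reflectCoord 0 x) hpinx' hpiny' hcP
  -- pull the event back
  have hprod : μR.prod (μR.map (configShift (Pi.single 0 (((-s : ℤˣ) : ℤ))))) =
      (μ.prod (μ.map (configShift (Pi.single 0 (s : ℤ))))).map (Prod.map ρ ρ) := by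
    rw [Units.val_neg, hμR, hρ, map_prod_reflectZero]
  rw [hprod, measureReal_def, Measure.map_apply (hρm.prodMap hρm) (measurableSet_goodTriple _ _ _ _ _)] at key
  rw [measureReal_def]
  refine key.trans (ENNReal.toReal_mono (measure_ne_top _ _) (measure_mono ?_))
  rintro p ⟨a', b', Px', M', Py', hPx', hM', hPy'⟩
  simp only [Prod.map_fst, Prod.map_snd] at hPx' hM' hPy'
  obtain ⟨Px, hPx⟩ := exists_starWalk_reflectZero (P := fun v => ρ p.1 v ≤ ρ p.2 v ∧ Qx (reflectCoord 0 v)) ⟨Py', hPy'⟩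
  obtain ⟨M, hM⟩ := exists_starWalk_reflectZero (P := fun v => ρ p.1 v ≤ ρ p.2 v ∧ PM (reflectCoord 0 v)) ⟨M', hM'⟩
  obtain ⟨Py, hPy⟩ := exists_starWalk_reflectZero (P := fun v => ρ p.1 v ≤ ρ p.2 v ∧ Qy (reflectCoord 0 v)) ⟨Px', hPx'⟩
  refine ⟨reflectCoord 0 b', reflectCoord 0 a', Px.copy (reflectCoord_reflectCoord 0 x) rfl, M.reverse,
    Py.copy (reflectCoord_reflectCoord 0 y) rfl, fun v hv => ?_, fun v hv => ?_, fun v hv => ?_⟩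
  · rw [Walk.support_copy] at hv
    have := hPx v hv
    rw [hρapp, hρapp, reflectCoord_reflectCoord] at this
    exact this
  · rw [Walk.support_reverse, List.mem_reverse] at hv
    have := hM v hv
    rw [hρapp, hρapp, reflectCoord_reflectCoord] at this
    exact this
  · rw [Walk.support_copy] at hv
    have := hPy v hv
    rw [hρapp, hρapp, reflectCoord_reflectCoord] at this
    exact this

end Right

end Literature.Probability.LatticeModels
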